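import Summits.HubbardSuperconductivity.HubbardLadder.KKTWindowRowsTL
import HarnessLib

/-!
# Rung R3/R4 — window certificate rows WITH a state-optimality (KKT) block, part 2: the half-filled
# ground state of every large even torus and torus-limit ground states of `ℤ²` (thermodynamic limit)

HONEST FRAMING (page 1): ladder R1–R4 with certified numbers; no claim on H/H₀.

Sequel of `KKTWindowRowsTL.lean` (split only for the tree's 400-line lint; the mathematical overview,
validity conditions and references of BOTH parts are in that file's module docstring). This part:

* §3 (half filling, even tori, `t ≠ 0`, `U > 0`): the window bound with KKT summand for every
  normalised `L²`-particle ground-state VECTOR (Lieb's uniqueness,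
  `LiebHalfFilled.hubbardTorus_groundState_expect_eq_projState`):
  `groundState_re_expect_ge_of_window_certificate_d4_kkt_ineq`, and its translation average
  `groundState_re_torusAvgExpectAt_ge_of_window_certificate_d4_kkt_ineq`.
* §4 (thermodynamic limit): for every torus-limit ground state `ω` of `ℤ²`
  (`InfVolFermionState.IsTorusLimitOf`, half filling) with `energyDensity2D t U 1 ≤ u` and `κ ≥ 0`:
  `c − Σₖ ‖aₖ‖ + (Σ_σ μ_σ)(1/2 − ν) ≤ Re ω(X)`
  (`isTorusLimitOf_re_expect_ge_of_window_certificate_d4_kkt_ineq`) — i.e. the `kkt` block is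
  ADMISSIBLE on the cell's thermodynamic-limit observable rows (docc / correlator windows).

## References
* O. Bratteli, D. W. Robinson, *Operator Algebras and Quantum Statistical Mechanics 2*, 2nd ed.
  (1997), Prop. 5.3.19, Prop. 5.3.25, §6.2.4. [cite: BratteliRobinsonII1997, Prop. 5.3.19]
* J. Wang et al., *Certifying ground-state properties of many-body systems*, PRX 14 (2024) 031006,
  §III. [cite: WangEtAl2024, §III]
* M. G. Scheer, N. Chadha, D.-C. Lu, E. Khalaf, arXiv:2511.20860, §II eq. (2).
  [cite: ScheerEtAl2025, §II eq. (2)]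
* H. Fawzi, O. Fawzi, S. O. Scalet, Nat. Commun. 15 (2024) 7394, §2. [cite: FawziFawziScalet2024, §2]
* E. H. Lieb, PRL 62 (1989) 1201, Theorem 2. [cite: LiebPRL1989, Theorem 2]
-/

noncomputable section

namespace Summit.HubbardSuperconductivity.HubbardLadder

open Literature.MathematicalPhysics.QuantumLattice Literature.Probability.LatticeModels
  Literature.MathematicalPhysics.QuantumManyBody.StateRelaxation
open Matrix Finset Filter
open scoped ComplexOrder BigOperators


/-! ## §3 Half filling: THE ground state of every large even torus, and its translation average -/

section HalfFilling

variable {d L : ℕ} [NeZero L]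

/-- (Local to this section, as in `HubbardCorrelatorCertificate`.) [folklore] -/
local instance (priority := high) instDecidableEqFermionTorusKKT'' : DecidableEq (FermionTorus d L) :=
  LinearOrder.toDecidableEq

/-- `2n = L²` ⇒ `n / L² = 1/2` (real form). [folklore] -/
private theorem half_of_two_mul_eq_sq' {L nh : ℕ} [NeZero L] (hnh : 2 * nh = L ^ 2) :
    (nh : ℝ) / (L : ℝ) ^ 2 = 1 / 2 := by
  have hL : (0 : ℝ) < (L : ℝ) ^ 2 := by
    have : (0 : ℝ) < L := by exact_mod_cast Nat.pos_of_ne_zero (NeZero.ne L)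
    positivity
  have h : (2 : ℝ) * nh = (L : ℝ) ^ 2 := by exact_mod_cast hnh
  rw [div_eq_iff hL.ne']
  linarith

/-- **Window certificate with energy constraint and KKT block ⇒ correlator of THE half-filled
ground state of every large even square torus.** Under the data of
`re_projState_ge_of_window_certificate_d4_kkt_ineq`, for even `L ≥ 3` with `x ↦ x mod L`
injective on `thicken Λ' 1`, `t ≠ 0`, `U > 0`, and every normalised `L²`-particle ground state `φ`
(unique, Lieb 1989 Theorem 2, and equal to the tracial state of the sector `(L², S^z = 0)`):
`c − Σₖ ‖aₖ‖ + (Σ_σ μ_σ)(1/2 − ν) + κ (u − E₀(L²)/L²) ≤ Re ⟨φ, Γ(ι_{Λ',L}) X φ⟩`.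
[cite: WangEtAl2024, §III] [cite: LiebPRL1989, Theorem 2] -/
theorem groundState_re_expect_ge_of_window_certificate_d4_kkt_ineq {L : ℕ} [NeZero L] (hLe : Even L)
    (hL : 3 ≤ L) {t U : ℝ} (ht : t ≠ 0) (hU : 0 < U)
    {Λ Λ' : Finset (Site 2)} (hΛ : Λ ⊆ Λ')
    (hclosed : ∀ x ∈ Λ, ∀ i : Fin 2, x + unitVec i ∈ Λ' ∧ x - unitVec i ∈ Λ')
    (h0 : thicken ({0} : Finset (Site 2)) 1 ⊆ Λ') (hz : (0 : Site 2) ∈ Λ')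
    (hInj : Set.InjOn (Torus.proj (d := 2) L) ↑(thicken Λ' 1))
    (hInj' : Set.InjOn (Torus.proj (d := 2) L) ↑Λ')
    (Xw : FermionOp Λ') (κ u : ℝ) (μ : Fin 2 → ℝ) (ν : ℝ)
    {m : Type*} [Fintype m] [DecidableEq m] {Λm : Matrix m m ℂ} (hΛm : Λm.PosSemidef)
    (O : m → FermionOp Λ')
    {κ' : Type*} (s : Finset κ') (B : κ' → FermionOp Λ)
    {ι : Type*} (tt : Finset ι) (γ : ι → DihedralGroup 4) (wv : ι → Site 2)
    (hsh : ∀ l, d4ShiftSet (γ l) (wv l) Λ ⊆ Λ') (Y : ι → FermionOp Λ)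
    {ρ : Type*} (uu : Finset ρ) (b : ρ → ℂ) (cw : ρ → List (Orb (PolySite Λ') × Bool))
    (hcw : ∀ j ∈ uu, ladderCharge (cw j) ≠ 0 ∨ ladderSpinCharge (cw j) ≠ 0)
    {δ : Type*} (ah : Finset δ) (dc : δ → ℝ) (V : δ → FermionOp Λ')
    {κ'' : Type*} (w : Finset κ'') (a : κ'' → ℂ) (word : κ'' → List (Orb (PolySite Λ') × Bool))
    {β : Type*} [Fintype β] [DecidableEq β] {G : Matrix β β ℂ} (hG : G.PosSemidef)
    (Bk : β → FermionOp Λ) (hBN : ∀ b', Commute (Bk b') totalNumber)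
    (hBS : ∀ b', Commute (Bk b') HubbardWave0.spinZ) {c : ℝ}
    (hcert : Xw - (c : ℂ) • (1 : FermionOp Λ') -
        ∑ σ : Fin 2, ((μ σ : ℝ) : ℂ) • (nAt 0 hz σ - ((ν : ℝ) : ℂ) • (1 : FermionOp Λ')) -
        ((κ : ℝ) : ℂ) • (((u : ℝ) : ℂ) • (1 : FermionOp Λ') -
          fermionEmbed (PolySite.incl h0) ((hubbardFermionInteraction 2 t U).meanEnergyObs 1)) =
      gramForm Λm O +
        (∑ k ∈ s, ((hubbardFermionInteraction 2 t U).localHamiltonian Λ' * fermionEmbed (PolySite.incl hΛ) (B k) -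
            fermionEmbed (PolySite.incl hΛ) (B k) * (hubbardFermionInteraction 2 t U).localHamiltonian Λ') +
          ∑ l ∈ tt, (fermionEmbed (PolySite.incl (hsh l)) (fermionEmbed (PolySite.d4Emb (γ l) (wv l) Λ) (Y l)) -
            fermionEmbed (PolySite.incl hΛ) (Y l)) +
          ∑ j ∈ uu, b j • ladderWord (cw j)) +
        (∑ m' ∈ ah, ((dc m' : ℝ) : ℂ) • ((V m')ᴴ - V m') + ∑ k ∈ w, a k • ladderWord (word k)) +
        kktForm ((hubbardFermionInteraction 2 t U).localHamiltonian Λ') G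
          (fun b' => fermionEmbed (PolySite.incl hΛ) (Bk b')))
    {φ : Fock (Orb (FermionTorus 2 L))}
    (hφ : _root_.Literature.MathematicalPhysics.QuantumLattice.IsGroundState
      (hamiltonian (fermionTorusGraph 2 L) t U) (L ^ 2) φ)
    (hφ1 : star φ ⬝ᵥ φ = 1) :
    c - ∑ k ∈ w, ‖a k‖ + (∑ σ : Fin 2, μ σ) * (1 / 2 - ν) +
        κ * (u - groundEnergyAt (fermionTorusGraph 2 L) t U (L ^ 2) / (L : ℝ) ^ 2) ≤
      (star φ ⬝ᵥ fermionEmbed (PolySite.toTorusEmb L hInj') Xw *ᵥ φ).re := by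
  -- the half-filled sector `2 nh = L²`
  obtain ⟨k, hk⟩ := hLe
  set nh : ℕ := L ^ 2 / 2 with hnhdef
  have hnh : 2 * nh = L ^ 2 := by
    have h2 : L ^ 2 = 2 * (k * (k + k)) := by rw [hk]; ring
    rw [hnhdef, h2, Nat.mul_div_cancel_left _ two_pos]
  have hn : nh ≤ Fintype.card (FermionTorus 2 L) := by
    have hcard : Fintype.card (FermionTorus 2 L) = L ^ 2 := by simp [FermionTorus]
    rw [hcard]
    omega
  have h := re_projState_ge_of_window_certificate_d4_kkt_ineq t U hL hn hΛ hclosed h0 hz hInj hInj' Xw κ u μ ν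
    hΛm O s B tt γ wv hsh Y uu b cw hcw ah dc V w a word hG Bk hBN hBS hcert
  rw [hnh, half_of_two_mul_eq_sq' hnh,
    ← LiebHalfFilled.hubbardTorus_groundState_expect_eq_projState ⟨k, hk⟩ ht hU hφ hφ1] at h
  exact h

/-- **Translation-averaged form**: under the hypotheses of
`groundState_re_expect_ge_of_window_certificate_d4_kkt_ineq`, the translation-AVERAGED
expectation `torusAvgExpectAt L Λ' X φ` (whose limits define torus-limit states,
`InfVolFermionState.IsTorusLimitOf`) obeys the same bound, since every translate `U_v φ` is again
a normalised ground state. [cite: WangEtAl2024, §III] [cite: BratteliRobinsonII1997, §6.2.4] -/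
theorem groundState_re_torusAvgExpectAt_ge_of_window_certificate_d4_kkt_ineq {L : ℕ} [NeZero L]
    (hLe : Even L) (hL : 3 ≤ L) {t U : ℝ} (ht : t ≠ 0) (hU : 0 < U)
    {Λ Λ' : Finset (Site 2)} (hΛ : Λ ⊆ Λ')
    (hclosed : ∀ x ∈ Λ, ∀ i : Fin 2, x + unitVec i ∈ Λ' ∧ x - unitVec i ∈ Λ')
    (h0 : thicken ({0} : Finset (Site 2)) 1 ⊆ Λ') (hz : (0 : Site 2) ∈ Λ')
    (hInj : Set.InjOn (Torus.proj (d := 2) L) ↑(thicken Λ' 1))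
    (Xw : FermionOp Λ') (κ u : ℝ) (μ : Fin 2 → ℝ) (ν : ℝ)
    {m : Type*} [Fintype m] [DecidableEq m] {Λm : Matrix m m ℂ} (hΛm : Λm.PosSemidef)
    (O : m → FermionOp Λ')
    {κ' : Type*} (s : Finset κ') (B : κ' → FermionOp Λ)
    {ι : Type*} (tt : Finset ι) (γ : ι → DihedralGroup 4) (wv : ι → Site 2)
    (hsh : ∀ l, d4ShiftSet (γ l) (wv l) Λ ⊆ Λ') (Y : ι → FermionOp Λ)
    {ρ : Type*} (uu : Finset ρ) (b : ρ → ℂ) (cw : ρ → List (Orb (PolySite Λ') × Bool))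
    (hcw : ∀ j ∈ uu, ladderCharge (cw j) ≠ 0 ∨ ladderSpinCharge (cw j) ≠ 0)
    {δ : Type*} (ah : Finset δ) (dc : δ → ℝ) (V : δ → FermionOp Λ')
    {κ'' : Type*} (w : Finset κ'') (a : κ'' → ℂ) (word : κ'' → List (Orb (PolySite Λ') × Bool))
    {β : Type*} [Fintype β] [DecidableEq β] {G : Matrix β β ℂ} (hG : G.PosSemidef)
    (Bk : β → FermionOp Λ) (hBN : ∀ b', Commute (Bk b') totalNumber)
    (hBS : ∀ b', Commute (Bk b') HubbardWave0.spinZ) {c : ℝ}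
    (hcert : Xw - (c : ℂ) • (1 : FermionOp Λ') -
        ∑ σ : Fin 2, ((μ σ : ℝ) : ℂ) • (nAt 0 hz σ - ((ν : ℝ) : ℂ) • (1 : FermionOp Λ')) -
        ((κ : ℝ) : ℂ) • (((u : ℝ) : ℂ) • (1 : FermionOp Λ') -
          fermionEmbed (PolySite.incl h0) ((hubbardFermionInteraction 2 t U).meanEnergyObs 1)) =
      gramForm Λm O +
        (∑ k ∈ s, ((hubbardFermionInteraction 2 t U).localHamiltonian Λ' * fermionEmbed (PolySite.incl hΛ) (B k) -
            fermionEmbed (PolySite.incl hΛ) (B k) * (hubbardFermionInteraction 2 t U).localHamiltonian Λ') +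
          ∑ l ∈ tt, (fermionEmbed (PolySite.incl (hsh l)) (fermionEmbed (PolySite.d4Emb (γ l) (wv l) Λ) (Y l)) -
            fermionEmbed (PolySite.incl hΛ) (Y l)) +
          ∑ j ∈ uu, b j • ladderWord (cw j)) +
        (∑ m' ∈ ah, ((dc m' : ℝ) : ℂ) • ((V m')ᴴ - V m') + ∑ k ∈ w, a k • ladderWord (word k)) +
        kktForm ((hubbardFermionInteraction 2 t U).localHamiltonian Λ') G
          (fun b' => fermionEmbed (PolySite.incl hΛ) (Bk b')))
    {φ : Fock (Orb (FermionTorus 2 L))}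
    (hφ : _root_.Literature.MathematicalPhysics.QuantumLattice.IsGroundState
      (hamiltonian (fermionTorusGraph 2 L) t U) (L ^ 2) φ)
    (hφ1 : star φ ⬝ᵥ φ = 1) :
    c - ∑ k ∈ w, ‖a k‖ + (∑ σ : Fin 2, μ σ) * (1 / 2 - ν) +
        κ * (u - groundEnergyAt (fermionTorusGraph 2 L) t U (L ^ 2) / (L : ℝ) ^ 2) ≤
      (torusAvgExpectAt L Λ' Xw φ).re := by
  have hInj' : Set.InjOn (Torus.proj (d := 2) L) ↑Λ' := hInj.mono (by exact_mod_cast subset_thicken Λ' 1)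
  set bnd : ℝ := c - ∑ k ∈ w, ‖a k‖ + (∑ σ : Fin 2, μ σ) * (1 / 2 - ν) +
    κ * (u - groundEnergyAt (fermionTorusGraph 2 L) t U (L ^ 2) / (L : ℝ) ^ 2) with hbnd
  have hterm : ∀ v : TorusSite 2 L, bnd ≤
      (expect (fermionEmbed (PolySite.toTorusEmb L hInj') Xw) ((fockTranslate v).val *ᵥ φ)).re := fun v =>
    groundState_re_expect_ge_of_window_certificate_d4_kkt_ineq hLe hL ht hU hΛ hclosed h0 hz hInj hInj' Xw κ u μ ν
      hΛm O s B tt γ wv hsh Y uu b cw hcw ah dc V w a word hG Bk hBN hBS hcert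
      (isGroundState_fockTranslate_mulVec t U v hφ) (by rw [star_dotProduct_fockTranslate_mulVec, hφ1])
  rw [torusAvgExpectAt_of_injOn L hInj' Xw φ, card_torusSite, ← Complex.ofReal_natCast,
    ← Complex.ofReal_inv, Complex.re_ofReal_mul, Complex.re_sum]
  have hLpos : (0 : ℝ) < ((L ^ 2 : ℕ) : ℝ) := by
    have : 0 < L := Nat.pos_of_ne_zero (NeZero.ne L)
    positivity
  have hsum : ((L ^ 2 : ℕ) : ℝ) * bnd ≤
      ∑ v : TorusSite 2 L, (expect (fermionEmbed (PolySite.toTorusEmb L hInj') Xw) ((fockTranslate v).val *ᵥ φ)).re := by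
    have h := Finset.card_nsmul_le_sum (Finset.univ : Finset (TorusSite 2 L)) _ bnd fun v _ => hterm v
    rw [Finset.card_univ, card_torusSite, nsmul_eq_mul] at h
    exact h
  rw [← inv_mul_le_iff₀ (inv_pos.2 hLpos), inv_inv]
  exact hsum

end HalfFilling

/-! ## §4 The thermodynamic limit: torus-limit ground states of `ℤ²` -/

section Limit

open Filter _root_.Topology

/-- **Certified correlator bounds with a KKT block for infinite-volume ground states of the
half-filled square-lattice Hubbard model.** Let `ω` be a torus-limit state
(`InfVolFermionState.IsTorusLimitOf`) of normalised half-filled ground states `ψ_L` of the even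
tori `(ℤ/Lℤ)²`, `L → ∞` (`t ≠ 0`, `U > 0`), and suppose `energyDensity2D t U 1 ≤ u`. Then a window
certificate with energy constraint `(κ ≥ 0, u)`, affine `D₄` reductions and a KKT block
`kktForm H_{Λ'} G (Γ(incl) ∘ B)` (`G ⪰ 0`, `B_b ∈ 𝔄_Λ` conserving the local `N̂` and `S^z`) for
the objective `X ∈ 𝔄_{Λ'}` proves `c − Σₖ ‖aₖ‖ + (Σ_σ μ_σ)(1/2 − ν) ≤ Re ω(X)`: the block kind `kkt`
is sound on the thermodynamic-limit observable rows. (Such `ω` exist: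
`LiebHalfFilled.exists_isTorusLimitOf_groundState`; they are locally stable,
`InfVolFermionState.IsTorusLimitOf.localStability`.) [cite: WangEtAl2024, §III]
[cite: BratteliRobinsonII1997, Prop. 5.3.25] [cite: ScheerEtAl2025, §II eq. (2)] -/
theorem isTorusLimitOf_re_expect_ge_of_window_certificate_d4_kkt_ineq
    {t U : ℝ} (ht : t ≠ 0) (hU : 0 < U) {κ u : ℝ} (hκ : 0 ≤ κ)
    (hu : ThermodynamicLimit.energyDensity2D t U 1 ≤ u)
    {Λ Λ' : Finset (Site 2)} (hΛ : Λ ⊆ Λ')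
    (hclosed : ∀ x ∈ Λ, ∀ i : Fin 2, x + unitVec i ∈ Λ' ∧ x - unitVec i ∈ Λ')
    (h0 : thicken ({0} : Finset (Site 2)) 1 ⊆ Λ') (hz : (0 : Site 2) ∈ Λ')
    (Xw : FermionOp Λ') (μ : Fin 2 → ℝ) (ν : ℝ)
    {m : Type*} [Fintype m] [DecidableEq m] {Λm : Matrix m m ℂ} (hΛm : Λm.PosSemidef)
    (O : m → FermionOp Λ')
    {κ' : Type*} (s : Finset κ') (B : κ' → FermionOp Λ)
    {ι : Type*} (tt : Finset ι) (γ : ι → DihedralGroup 4) (wv : ι → Site 2)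
    (hsh : ∀ l, d4ShiftSet (γ l) (wv l) Λ ⊆ Λ') (Y : ι → FermionOp Λ)
    {ρ : Type*} (uu : Finset ρ) (b : ρ → ℂ) (cw : ρ → List (Orb (PolySite Λ') × Bool))
    (hcw : ∀ j ∈ uu, ladderCharge (cw j) ≠ 0 ∨ ladderSpinCharge (cw j) ≠ 0)
    {δ : Type*} (ah : Finset δ) (dc : δ → ℝ) (V : δ → FermionOp Λ')
    {κ'' : Type*} (w : Finset κ'') (a : κ'' → ℂ) (word : κ'' → List (Orb (PolySite Λ') × Bool))
    {β : Type*} [Fintype β] [DecidableEq β] {G : Matrix β β ℂ} (hG : G.PosSemidef)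
    (Bk : β → FermionOp Λ) (hBN : ∀ b', Commute (Bk b') totalNumber)
    (hBS : ∀ b', Commute (Bk b') HubbardWave0.spinZ) {c : ℝ}
    (hcert : Xw - (c : ℂ) • (1 : FermionOp Λ') -
        ∑ σ : Fin 2, ((μ σ : ℝ) : ℂ) • (nAt 0 hz σ - ((ν : ℝ) : ℂ) • (1 : FermionOp Λ')) -
        ((κ : ℝ) : ℂ) • (((u : ℝ) : ℂ) • (1 : FermionOp Λ') -
          fermionEmbed (PolySite.incl h0) ((hubbardFermionInteraction 2 t U).meanEnergyObs 1)) =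
      gramForm Λm O +
        (∑ k ∈ s, ((hubbardFermionInteraction 2 t U).localHamiltonian Λ' * fermionEmbed (PolySite.incl hΛ) (B k) -
            fermionEmbed (PolySite.incl hΛ) (B k) * (hubbardFermionInteraction 2 t U).localHamiltonian Λ') +
          ∑ l ∈ tt, (fermionEmbed (PolySite.incl (hsh l)) (fermionEmbed (PolySite.d4Emb (γ l) (wv l) Λ) (Y l)) -
            fermionEmbed (PolySite.incl hΛ) (Y l)) +
          ∑ j ∈ uu, b j • ladderWord (cw j)) +
        (∑ m' ∈ ah, ((dc m' : ℝ) : ℂ) • ((V m')ᴴ - V m') + ∑ k ∈ w, a k • ladderWord (word k)) +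
        kktForm ((hubbardFermionInteraction 2 t U).localHamiltonian Λ') G
          (fun b' => fermionEmbed (PolySite.incl hΛ) (Bk b')))
    {Ls : ℕ → ℕ} (hLs : Tendsto Ls atTop atTop) (hev : ∀ j, Even (Ls j))
    {ψ : ∀ L, Fock (Orb (FermionTorus 2 L))}
    (hψ : ∀ j, _root_.Literature.MathematicalPhysics.QuantumLattice.IsGroundState
      (hamiltonian (fermionTorusGraph 2 (Ls j)) t U) (Ls j ^ 2) (ψ (Ls j)))
    (hψ1 : ∀ j, star (ψ (Ls j)) ⬝ᵥ ψ (Ls j) = 1)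
    {ω : InfVolFermionState 2} (hω : ω.IsTorusLimitOf ψ Ls) :
    c - ∑ k ∈ w, ‖a k‖ + (∑ σ : Fin 2, μ σ) * (1 / 2 - ν) ≤ (ω.expect Λ' Xw).re := by
  -- the averaged torus expectations converge to `ω(X)`
  have hlim : Tendsto (fun j => (torusAvgExpect (Ls j) Λ' Xw (ψ (Ls j))).re) atTop
      (𝓝 (ω.expect Λ' Xw).re) :=
    (Complex.continuous_re.tendsto _).comp (hω Λ' Xw)
  -- the energies per site converge to the thermodynamic-limit density
  have hE : Tendsto (fun j => groundEnergyAt (fermionTorusGraph 2 (Ls j)) t U (Ls j ^ 2) / ((Ls j : ℕ) : ℝ) ^ 2)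
      atTop (𝓝 (ThermodynamicLimit.energyDensity2D t U 1)) := by
    have h := (ThermodynamicLimit.tendsto_energyDensity2D_torus t hU.le zero_le_one one_lt_two).comp hLs
    refine h.congr fun j => ?_
    simp only [Function.comp_apply, HartreeFock.rectN_one_of_even (hev j)]
  set b0 : ℝ := c - ∑ k ∈ w, ‖a k‖ + (∑ σ : Fin 2, μ σ) * (1 / 2 - ν) with hb0
  have hbnd : Tendsto (fun j => b0 + κ * (u - groundEnergyAt (fermionTorusGraph 2 (Ls j)) t U (Ls j ^ 2) /
      ((Ls j : ℕ) : ℝ) ^ 2)) atTop (𝓝 (b0 + κ * (u - ThermodynamicLimit.energyDensity2D t U 1))) :=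
    tendsto_const_nhds.add ((tendsto_const_nhds.sub hE).const_mul κ)
  -- the finite-torus inequality holds for all large `j`
  obtain ⟨L₀, hL₀⟩ := exists_forall_le_injOn_proj (thicken Λ' 1)
  have hev' : ∀ᶠ j in atTop, b0 + κ * (u - groundEnergyAt (fermionTorusGraph 2 (Ls j)) t U (Ls j ^ 2) /
      ((Ls j : ℕ) : ℝ) ^ 2) ≤ (torusAvgExpect (Ls j) Λ' Xw (ψ (Ls j))).re := by
    filter_upwards [hLs.eventually (eventually_ge_atTop (max L₀ 3))] with j hj
    have hL3 : 3 ≤ Ls j := le_trans (le_max_right _ _) hj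
    have hLL : L₀ ≤ Ls j := le_trans (le_max_left _ _) hj
    haveI : NeZero (Ls j) := ⟨by omega⟩
    rw [torusAvgExpect_eq]
    exact groundState_re_torusAvgExpectAt_ge_of_window_certificate_d4_kkt_ineq (hev j) hL3 ht hU hΛ hclosed h0 hz
      (hL₀ (Ls j) hLL) Xw κ u μ ν hΛm O s B tt γ wv hsh Y uu b cw hcw ah dc V w a word hG Bk hBN hBS hcert
      (hψ j) (hψ1 j)
  have hle := le_of_tendsto_of_tendsto hbnd hlim hev'
  have hslack : 0 ≤ κ * (u - ThermodynamicLimit.energyDensity2D t U 1) := mul_nonneg hκ (sub_nonneg.2 hu)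
  linarith

end Limit

end Summit.HubbardSuperconductivity.HubbardLadder
end
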